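import Summits.QuantumFields.BalabanUV.Beta.EriceRemainderEnclosureHistoryAutonomyComparisonBudgetedCriterion
import Summits.QuantumFields.BalabanUV.Beta.EriceRemainderEnclosureHistoryAutonomyComparisonCubeBudget

/-!
# EriceRemainderEnclosureHistoryAutonomyComparisonCubeBudgetedCriterion — (E70g) THE CUBE-BUDGETED SLACK CRITERION: (E65b)'s socket with (E70b)'s cube
# transport HANDED TO THE CERTIFICATE — for every budgeted load vector the certificate may also use, at every scale `j ≥ 1`, a pin share `ε ∈ [0,1]`
# and level ratios `ρ_k ≥ 0` (`k > j`: `ρ_k ≥ 1`, `ρ_k³ = σ_k²`, `j·σ_k + (k−j)·ε ≥ k`; `k ≤ j`: `j·ρ_k ≥ k`) with **`ε + Σ_{k∈A} 2x_k·(S_{k,j}∕k)·ρ_k ≤ 1`**;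
# if such certificates always exist, `B = b + Σ L_k u_k` compares at any size under every isotone excess

Cell `pub-balaban`, β-function sub-cell, BINDER row D4 «RemainderConst leaves for Bałaban's split» (`HOME/BINDER-OWNERS.md`; owner lineage `b2b-balaban-beta-an4`;
this file by co-owner #2 lineage `b2b-balaban-beta-d4-p2`, generation 60), β-FLOW TEAM duty (1), FREEZE (0) honoured (def-free; (E65b)'s `budget_on_ages`, (E64e)'s
`effective_le_of_family_le_at_certificate`, (E63a)'s `le_of_isotone_excess_of_step_below`, (E70b)'s `levelRatio_budget_window` ∕ `old_cube_transport` ∕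
`young_level_transport`, (E58b)'s `weight_le_profile`, (E41)'s `affine_monotone` ∕ `affine_floor` ∕ `affine_zerothMoment`, (E48a)'s `strictAnti_of_memFlow` BY NAME;
nothing restated).

HONEST FRAMING (page 1, verbatim and binding).  *"Discharging BetaPertH makes Bałaban's UV stability UNCONDITIONAL — a real constructive-QFT result; it is
NOT the continuum limit and NOT the Clay problem."*  THIS FILE DISCHARGES NOTHING OF THE KIND.  Elementary real analysis about ABSTRACT affine functionals on a
box ]0,γ]^ℕ with displayed floors, profiles and signs — hypotheses of a census, not facts; the form, signs, ages and moments of Bałaban's (1.22) limit functional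
are NOT PRINTED ([I] p. 298; GAPS G-t4-U2-1∕-2) and NOT asserted.  Row D4 class UNCHANGED (critical-path width 0; instance 0∕1; D4 DISCHARGE NO DATE).  HONEST
DEPENDENCY: continuum YM on T⁴ ⇐ BetaPertH ∧ nine spine estimates (0/9 proved); BetaPertH ⇐ (D1) ∧ (D4) ∧ CAP+tail; G-an2-4 gates asym, D1 and NE2/3/4.

THE POINT (census sense (α); the COMPARISON column, conjecture (E58′), the budgeted programme (C″)).  (E65b) hands each certificate the profile bound and the
WINDOW BUDGET, whose old-on-young weight `S_{k,j}∕k ≈ j∕k` is (E70b)'s level ratio `(h_j∕h_k)²` transported by `≥ 1`.  Here the certificate ALSO receives the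
exact-ratio budget in trajectory-free form: reals `ε = (h_j∕h_0)²`, `ρ_k = (h_j∕h_k)²`, `σ_k = (h_j∕h_k)³` stripped of the trajectory and constrained only by what
the tree proves of them — `0 ≤ ε ≤ 1`, `ρ_k ≥ 0`, `ρ_k ≥ 1` and `j·σ_k + (k−j)·ε ≥ k` for old ages ((E70b) `old_cube_transport`, with `(h_j∕h_0)³ ≤ (h_j∕h_0)²`),
`ρ_k³ = σ_k²`, `j·ρ_k ≥ k` for young ages ((E70b) `young_level_transport`), and `ε + Σ_k 2x_k(S_{k,j}∕k)ρ_k ≤ 1` ((E70b) `levelRatio_budget_window`).  The old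
side is the cube transport (`ρ_k ≳ (k∕j)^{2∕3}` away from the pin): admissible uniform tower loads drop `0.098 → 0.065` (R = 2), `0.154 → 0.101` (R = 3),
`0.191 → 0.126` (R = 4) (`HOME/b2b-balaban-beta-d4-p2/g60/e70/README.md`) — the room the successor's chain∕DP route (C″-cube) needs at ratios `≤ 3`.  NOT CLAIMED:
that every cube-budgeted load vector has a certificate; anything printed.

WHAT IS PROVED ([folklore]; 0 `def`, 0 sorry).  `cube_budget_on_ages` (the trajectory-free cube budget along every base solution), **`le_of_isotone_excess_cube_budgeted_certificate`** (END).
-/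
noncomputable section
open Finset Set

namespace Summit.QuantumFields.BalabanUV.Beta.EriceRemainderEnclosureHistoryAutonomyComparisonCubeBudgetedCriterion

open Literature.MathematicalPhysics.QuantumFieldTheory.Balaban1983to89
open Literature.MathematicalPhysics.QuantumFieldTheory.Balaban1983to89.T4BetaStationary
open Literature.MathematicalPhysics.QuantumFieldTheory.Balaban1983to89.T4BetaFlowWellPosed
open Summit.QuantumFields.BalabanUV.Beta.EriceRemainderEnclosureHistoryAutonomyOrder (strictAnti_of_memFlow)
open Summit.QuantumFields.BalabanUV.Beta.EriceRemainderEnclosureHistoryAutonomyComparisonAffineProfile (weight_le_profile)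
open Summit.QuantumFields.BalabanUV.Beta.EriceRemainderEnclosureHistoryAutonomyComparisonDropBound (le_of_isotone_excess_of_step_below)
open Summit.QuantumFields.BalabanUV.Beta.EriceRemainderEnclosureHistoryAutonomyComparisonSlackCriterion (effective_le_of_family_le_at_certificate)
open Summit.QuantumFields.BalabanUV.Beta.EriceRemainderEnclosureHistoryAutonomyComparisonBudgetedCriterion (budget_on_ages)
open Summit.QuantumFields.BalabanUV.Beta.EriceRemainderEnclosureHistoryAutonomyComparisonCubeBudget
  (levelRatio_budget_window old_cube_transport young_level_transport)
open Summit.QuantumFields.BalabanUV.Beta.EriceRemainderEnclosureHistoryAutonomyMonotone (affine_monotone affine_floor affine_zerothMoment)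

variable {B' : (ℕ → ℝ) → ℝ} {M' γ b y : ℝ} {L : ℕ → ℝ} {K : ℕ} {A : Finset ℕ} {h h' : ℕ → ℝ}

/-- **THE TRAJECTORY-FREE CUBE BUDGET ON THE AGES.**  Along every box solution `h` of `B(u) = b + Σ_{k<K} L_k·u_k` (`b > 0`, `L ≥ 0`) from every pin `y > 0`,
for every finite `A ⊆ [0,K[` and every scale `j`, the loads `x_k = L_k·k·h_k³∕2` admit reals `ε` and `ρ_k ≥ 0, σ_k` with `0 ≤ ε ≤ 1`, `ρ_k ≥ 1`
for `j < k`, `ρ_k³ = σ_k²`, `j·ρ_k ≥ k` for `k ≤ j`, `j·σ_k + (k − j)·ε ≥ k` for `j < k`, and **`ε + Σ_{k∈A} 2x_k·(S_{k,j}∕k)·ρ_k ≤ 1`** — namely `ε = (h_j∕h_0)²`,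
`ρ_k = (h_j∕h_k)²`, `σ_k = (h_j∕h_k)³` ((E70b)). [folklore] -/
theorem cube_budget_on_ages (hL : ∀ k, 0 ≤ L k) (hb : 0 < b) (hAK : A ⊆ range K) (hy : 0 < y) (hh : SeqBox γ h)
    (hf : MemFlow (fun u : ℕ → ℝ => b + ∑ k ∈ range K, L k * u k) y h) (j : ℕ) :
    ∃ ε : ℝ, ∃ ρ σ : ℕ → ℝ, 0 ≤ ε ∧ ε ≤ 1 ∧ (∀ k, 0 ≤ ρ k) ∧ (∀ k, j < k → 1 ≤ ρ k) ∧ (∀ k, ρ k ^ 3 = σ k ^ 2) ∧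
      (∀ k, k ≤ j → (k : ℝ) ≤ j * ρ k) ∧ (∀ k, j < k → (k : ℝ) ≤ j * σ k + ((k : ℝ) - j) * ε) ∧
      ε + ∑ k ∈ A, 2 * (L k * k * h k ^ 3 / 2) * ((∑ l ∈ range j, Real.sqrt ((k : ℝ) / ((k : ℝ) + l + 1))) / k) * ρ k ≤ 1 := by
  have hmono := affine_monotone (γ := γ) (b₀ := b) (K := K) hL
  have hlo := affine_floor (γ := γ) (b₀ := b) (K := K) hL
  have hdom : ∀ u, SeqBox γ u → ∑ k ∈ range K, L k * u k ≤ (fun u : ℕ → ℝ => b + ∑ k ∈ range K, L k * u k) u := fun u _ => by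
    simp only; linarith
  have hanti := (strictAnti_of_memFlow hb hlo hh hf).antitone
  have hhj := (hh j).1
  have hh0 := (hh 0).1
  refine ⟨(h j / h 0) ^ 2, fun k => (h j / h k) ^ 2, fun k => (h j / h k) ^ 3, by positivity, ?_, ?_, ?_, ?_, ?_, ?_, ?_⟩
  · -- ε ≤ 1: h j ≤ h 0
    have : h j / h 0 ≤ 1 := (div_le_one hh0).mpr (hanti (Nat.zero_le j))
    have h0 : 0 ≤ h j / h 0 := by positivity
    nlinarith
  · intro k; have := (hh k).1; positivity
  · intro k hjk
    have hhk := (hh k).1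
    have : 1 ≤ h j / h k := by rw [le_div_iff₀ hhk]; simpa using hanti hjk.le
    nlinarith
  · intro k; ring
  · intro k hkj
    exact young_level_transport hmono hb hlo hy hh hf hkj
  · intro k hjk
    have hc := old_cube_transport (γ := γ) hL hb hh hf hjk.le
    -- (h j / h 0)^3 ≤ (h j / h 0)^2
    have hr1 : h j / h 0 ≤ 1 := (div_le_one hh0).mpr (hanti (Nat.zero_le j))
    have hr0 : 0 ≤ h j / h 0 := by positivity
    have h32 : (h j / h 0) ^ 3 ≤ (h j / h 0) ^ 2 := by nlinarith [mul_nonneg hr0 hr0]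
    have hkj' : (0 : ℝ) ≤ (k : ℝ) - j := by
      have : (j : ℝ) ≤ k := by exact_mod_cast hjk.le
      linarith
    nlinarith [mul_le_mul_of_nonneg_left h32 hkj']
  · have hbud := levelRatio_budget_window hmono hL hb hlo hdom hy hh hf j
    have hnn : ∀ k ∈ range K, 0 ≤ L k * k * h k ^ 3 * ((∑ l ∈ range j, Real.sqrt ((k : ℝ) / ((k : ℝ) + l + 1))) / k) * (h j / h k) ^ 2 := by
      intro k _
      have := (hh k).1; have := hL k
      have : 0 ≤ (∑ l ∈ range j, Real.sqrt ((k : ℝ) / ((k : ℝ) + l + 1))) := sum_nonneg fun _ _ => Real.sqrt_nonneg _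
      positivity
    have hsub := sum_le_sum_of_subset_of_nonneg hAK fun k hk _ => hnn k hk
    have e : ∑ k ∈ A, 2 * (L k * k * h k ^ 3 / 2) * ((∑ l ∈ range j, Real.sqrt ((k : ℝ) / ((k : ℝ) + l + 1))) / k) * (h j / h k) ^ 2 =
        ∑ k ∈ A, L k * k * h k ^ 3 * ((∑ l ∈ range j, Real.sqrt ((k : ℝ) / ((k : ℝ) + l + 1))) / k) * (h j / h k) ^ 2 :=
      sum_congr rfl fun k _ => by ring
    rw [e]
    linarith

/-- **THE CUBE-BUDGETED SLACK CRITERION.**  `B(u) = b + Σ_{k<K} L_k·u_k` on ]0,γ] (`b > 0`, `L ≥ 0` supported on `{0} ∪ A`, `A ⊆ [1,K[`; sizes and Markov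
weight ARBITRARY).  Suppose that FOR EVERY load vector `x ≥ 0` on `A` obeying (i) the profile bound `x_k ≤ L_k∕(2P_k)`, (ii) (E65a)'s WINDOW BUDGET at every
scale `j ≥ 1`, AND (iii) the CUBE BUDGET at every scale `j ≥ 1` — reals `ε ∈ [0,1]`, `ρ_k ≥ 0` (`≥ 1` for `k > j`), `σ_k` with `ρ_k³ = σ_k²`, `j·ρ_k ≥ k` (`k ≤ j`),
`j·σ_k + (k−j)·ε ≥ k` (`j < k`), `ε + Σ_{k∈A} 2x_k(S_{k,j}∕k)ρ_k ≤ 1` — there is a certificate `π ≥ 0` with `π_{k′} + Σ_j x_j(k′∕(k′+j))²π_j ≥ 1` and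
`Σ_j x_jπ_j ≤ 1`.  Then every `B′ ≥ B` with a zeroth moment and an ISOTONE excess compares: ANY box solutions from one pin satisfy `h′ ≤ h` at EVERY scale.
(E65b)'s proof with `cube_budget_on_ages` added to the true loads' dossier. [folklore] -/
theorem le_of_isotone_excess_cube_budgeted_certificate {p : ℝ} (hL : ∀ k, 0 ≤ L k) (hb : 0 < b) (hAK : A ⊆ range K) (hA1 : ∀ k ∈ A, 1 ≤ k)
    (hsupp : ∀ k ∈ range K, k ∉ A → k ≠ 0 → L k = 0)
    (hcert : ∀ x : ℕ → ℝ, (∀ k ∈ A, 0 ≤ x k) →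
      (∀ k ∈ A, x k ≤ L k / (2 * ∑ k' ∈ range K, L k' * Real.sqrt ((k : ℝ) / ((k : ℝ) + k')))) →
      (∀ j : ℕ, 1 ≤ j → ∑ k ∈ A, x k *
        (if k ≤ j then (∑ l ∈ range j, Real.sqrt ((k : ℝ) / ((k : ℝ) + l + 1))) / j
          else (∑ l ∈ range j, Real.sqrt ((k : ℝ) / ((k : ℝ) + l + 1))) / k) ≤ 1 / 2) →
      (∀ j : ℕ, 1 ≤ j → ∃ ε : ℝ, ∃ ρ σ : ℕ → ℝ, 0 ≤ ε ∧ ε ≤ 1 ∧ (∀ k, 0 ≤ ρ k) ∧ (∀ k, j < k → 1 ≤ ρ k) ∧ (∀ k, ρ k ^ 3 = σ k ^ 2) ∧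
        (∀ k, k ≤ j → (k : ℝ) ≤ j * ρ k) ∧ (∀ k, j < k → (k : ℝ) ≤ j * σ k + ((k : ℝ) - j) * ε) ∧
        ε + ∑ k ∈ A, 2 * x k * ((∑ l ∈ range j, Real.sqrt ((k : ℝ) / ((k : ℝ) + l + 1))) / k) * ρ k ≤ 1) →
      ∃ π : ℕ → ℝ, (∀ k ∈ A, 0 ≤ π k) ∧
        (∀ k' ∈ A, 1 ≤ π k' + ∑ j ∈ A, x j * ((k' : ℝ) / ((k' : ℝ) + j)) ^ 2 * π j) ∧ ∑ j ∈ A, x j * π j ≤ 1)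
    (hB' : ∀ u u' : ℕ → ℝ, SeqBox γ u → SeqBox γ u' → ∀ D : ℝ, (∀ j, |u j - u' j| ≤ D) → |B' u - B' u'| ≤ M' * D) (hM' : 0 ≤ M')
    (hexc : ∀ u, SeqBox γ u → (fun u : ℕ → ℝ => b + ∑ k ∈ range K, L k * u k) u ≤ B' u)
    (hDmono : ∀ u v : ℕ → ℝ, SeqBox γ u → SeqBox γ v → (∀ j, u j ≤ v j) →
      B' u - (fun u : ℕ → ℝ => b + ∑ k ∈ range K, L k * u k) u ≤ B' v - (fun u : ℕ → ℝ => b + ∑ k ∈ range K, L k * u k) v)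
    (hp : 0 < p) (hpγ : p ≤ γ) (hh : SeqBox γ h) (hf : MemFlow (fun u : ℕ → ℝ => b + ∑ k ∈ range K, L k * u k) p h)
    (hh' : SeqBox γ h') (hf' : MemFlow B' p h') (j : ℕ) : h' j ≤ h j := by
  have hmono := affine_monotone (γ := γ) (b₀ := b) (K := K) hL
  have hlo := affine_floor (γ := γ) (b₀ := b) (K := K) hL
  have hdom : ∀ u, SeqBox γ u → ∑ k ∈ range K, L k * u k ≤ (fun u : ℕ → ℝ => b + ∑ k ∈ range K, L k * u k) u := fun u _ => by
    simp only; linarith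
  refine le_of_isotone_excess_of_step_below (B := fun u : ℕ → ℝ => b + ∑ k ∈ range K, L k * u k) hmono
    (affine_zerothMoment hL) (sum_nonneg fun k _ => hL k) hb hlo hB' hM' hexc hDmono
    (fun _ _ hS huniq hS' huniq' _ hy _ hdeep u _ hu hfu hu' hfu' hle => ?_) hp hpγ hh hf hh' hf' j
  -- the true loads of the base solution at this pin
  have hx0 : ∀ k ∈ A, 0 ≤ L k * k * u k ^ 3 / 2 := fun k _ => by have := (hu k).1; have := hL k; positivity
  have hxP : ∀ k ∈ A, L k * k * u k ^ 3 / 2 ≤ L k / (2 * ∑ k' ∈ range K, L k' * Real.sqrt ((k : ℝ) / ((k : ℝ) + k'))) := by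
    intro k hkA
    have := weight_le_profile hmono hL hb hlo hdom hy hu hfu (hAK hkA)
    rw [show L k / (2 * ∑ k' ∈ range K, L k' * Real.sqrt ((k : ℝ) / ((k : ℝ) + k'))) =
        L k / (∑ k' ∈ range K, L k' * Real.sqrt ((k : ℝ) / ((k : ℝ) + k'))) / 2 by rw [div_div, mul_comm]]
    linarith
  have hxB : ∀ j : ℕ, 1 ≤ j → ∑ k ∈ A, L k * k * u k ^ 3 / 2 *
      (if k ≤ j then (∑ l ∈ range j, Real.sqrt ((k : ℝ) / ((k : ℝ) + l + 1))) / j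
        else (∑ l ∈ range j, Real.sqrt ((k : ℝ) / ((k : ℝ) + l + 1))) / k) ≤ 1 / 2 :=
    fun j hj => budget_on_ages hL hb hAK hy hu hfu hj
  have hxC : ∀ j : ℕ, 1 ≤ j → ∃ ε : ℝ, ∃ ρ σ : ℕ → ℝ, 0 ≤ ε ∧ ε ≤ 1 ∧ (∀ k, 0 ≤ ρ k) ∧ (∀ k, j < k → 1 ≤ ρ k) ∧ (∀ k, ρ k ^ 3 = σ k ^ 2) ∧
      (∀ k, k ≤ j → (k : ℝ) ≤ j * ρ k) ∧ (∀ k, j < k → (k : ℝ) ≤ j * σ k + ((k : ℝ) - j) * ε) ∧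
      ε + ∑ k ∈ A, 2 * (L k * k * u k ^ 3 / 2) * ((∑ l ∈ range j, Real.sqrt ((k : ℝ) / ((k : ℝ) + l + 1))) / k) * ρ k ≤ 1 :=
    fun j _ => cube_budget_on_ages hL hb hAK hy hu hfu j
  obtain ⟨π, hπ, hdual, hcost⟩ := hcert (fun k => L k * k * u k ^ 3 / 2) hx0 hxP hxB hxC
  exact effective_le_of_family_le_at_certificate (xh := fun k => L k * k * u k ^ 3 / 2)
    hL hb hAK hA1 hsupp hexc hDmono hS huniq hS' huniq' hy hdeep hu hfu hu' hfu' hle (fun j _ => by ring_nf; rfl) hπ hdual hcost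

end Summit.QuantumFields.BalabanUV.Beta.EriceRemainderEnclosureHistoryAutonomyComparisonCubeBudgetedCriterion

end
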